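import Summits.AtomisticToContinuum.HydrodynamicLimit.Theorems.PolynomialCompression.Negative.PdeForm
import Summits.AtomisticToContinuum.HydrodynamicLimit.Theorems.ImplosionDichotomyPolynomialCompressionEosRatioAnalytic
import Mathlib.Analysis.Analytic.ChangeOrigin
import Mathlib.Analysis.Calculus.FDeriv.Analytic
import Mathlib.Analysis.Calculus.Deriv.Inverse
import Mathlib.Analysis.Calculus.InverseFunctionTheorem.ContDiff
import Mathlib.Analysis.Calculus.ContDiff.RCLike
import HarnessLib

/-!
# The packing-guarded hydrodynamic limit is a statement about SMOOTH profiles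
# (cruxes `HydroLimitProfilewiseBand`, stmt-AtomisticToContinuum-17372, and `HydroLimitInBand`, stmt-9133)

Support file (`--supports stmt-AtomisticToContinuum-17372`), line lead `prover-line-stmt-AtomisticToContinuum-17372-c3-0`.

Both cruxes quantify over merely CONTINUOUS positive profiles `(a₀, u₀, θ₀)`, but the inner implication is about
CLASSICAL (jointly `C^∞`) hard-sphere Euler solutions TIED at `t = 0` to the local Gibbs laws. Data pinning
(`PolynomialCompressionPDE.admissible_iff_data`: a tied solution has `ρ 0 = rhoLim (profileOf a₀) σ`, `u 0 = u₀`,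
`θ 0 = θ₀`) and smoothness of time slices (`IsSmoothSpaceTimeOn.isSmooth_slice`) make the inner implication VACUOUS
unless `u₀`, `θ₀` — and, through the pinned density, `a₀` — are `C^∞`. The velocity/temperature half is the sibling
disprover's `inner_holds_of_not_isSmooth` (`Cruxes/HydroLimitInBand/Disproof.lean`, not importable), which leaves the
activity half open: "the same holds for `a₀`, through the analytic pointwise map `β ↦ rhoLim`; not formalised here".
This file formalises it and records the consequence:

* §1 `rhoLim_eq_insertion` — the pinned density is a FIXED analytic function of the profile:
  `rhoLim P σ x = R β(x) · Φ(σ³ R β(x))`, `Φ(s) = ∑ⱼ bⱼ sʲ/j!` the insertion series of the landed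
  `EosRatioAnalytic.eosPhi_spec` (analytic at `0`, `Φ 0 = 1`; `bⱼ = bE j` the cluster integrals), `R = ratioLimit P σ ∈
  [1/2, 2]`; `insertionMap_smooth_deriv_ne` — `y ↦ R y Φ(κy)` is `C^∞` with non-zero derivative while `|κy|` is small.
* §2 `torus_isSmooth_of_isSmooth_comp` — on `𝕋³`, a continuous `β` is smooth as soon as `G ∘ β` is smooth for a
  real function `G` that is `C^∞` with non-vanishing derivative along the range of `β` (local inverse function theorem).
* §3 `isSmooth_β_of_isSmooth_rhoLim` — hence, for `σ` below a profile threshold, `rhoLim P σ` smooth ⇒ `β` smooth;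
  `isSmooth_profiles_of_tied` — profiles admitting a TIED classical solution at some small `σ` are `C^∞`;
  `inner_holds_of_not_isSmooth_profiles` — if one of `a₀, u₀, θ₀` is not `C^∞`, the inner implication of the cruxes
  holds vacuously at every small `σ` and every cap `η`.
* §4 `hydroLimitProfilewiseBand_iff_smooth`, `hydroLimitInBand_iff_smooth`, `statement_iff_smooth` — each crux, and the
  sub-problem Statement `HydrodynamicLimit` itself, is EQUIVALENT to its restriction to `C^∞` profiles (the same
  statement with `Continuous a₀/θ₀/u₀` replaced by `Torus.IsSmooth a₀/θ₀/u₀`, written out verbatim — no new definition).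
  Any positive line may assume smooth profiles; any refutation witness can be taken with smooth profiles.

References: H. Spohn, *Large Scale Dynamics of Interacting Particles* (1991), Part I §3.2–3.3; D. Ruelle,
*Statistical Mechanics: Rigorous Results* (1969), §4.2 (activity expansion of the density).
-/

noncomputable section

open MeasureTheory Filter Set Topology
open scoped ContDiff

namespace Summit.AtomisticToContinuum.HydrodynamicLimit.Theorems

namespace HydroLimitBandSmooth

open Literature.MathematicalPhysics.KineticTheory Literature.Analysis.FluidPDE
open Literature.Analysis.FunctionSpaces
open PolynomialCompressionPDE (Flows admissible_iff_data continuous_slices_zero tendstoHydroFieldsAt_zero_iff_flowFree)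

/-! ## §1 The pinned density as a fixed analytic function of the profile -/

/-- `clusterCoeff σ j = (σ³)ʲ · (bⱼ/j!)`. [folklore] -/
theorem clusterCoeff_eq (σ : ℝ) (j : ℕ) : clusterCoeff σ j = (σ ^ 3) ^ j * (bE j / (Nat.factorial j : ℝ)) := by
  rw [clusterCoeff]; ring

/-- **The pinned density is the insertion map applied to the profile**: for any function `Φ` summing the insertion
series `Φ u = ∑ⱼ (bⱼ/j!) uʲ` (such a `Φ`, analytic at `0` with `Φ 0 = 1`, is `EosRatioAnalytic.eosPhi_spec`),
`rhoLim P σ x = R β(x) Φ(σ³ R β(x))` with `R = ratioLimit P σ` — for every `σ` (pure rearrangement of the defining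
series `∑ⱼ γⱼ R^{j+1} β^{j+1}`, `γⱼ = (σ³)ʲ bⱼ/j!`). [folklore] -/
theorem rhoLim_eq_insertion {Φ : ℝ → ℝ} (hΦ : ∀ u, Φ u = ∑' j : ℕ, bE j / (j.factorial : ℝ) * u ^ j)
    (P : DensityProfile) (σ : ℝ) (x : T3) :
    rhoLim P σ x = ratioLimit P σ * P.β x * Φ (σ ^ 3 * ratioLimit P σ * P.β x) := by
  rw [rhoLim, hΦ, ← tsum_mul_left]
  refine tsum_congr fun j => ?_
  rw [clusterCoeff_eq]
  ring

/-- **The insertion map** `y ↦ R y Φ(κ y)` has non-vanishing derivative `R (Φ(κy) + κy Φ'(κy))` as long as `|κ y|` is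
small: for `Φ` analytic at `0` with `Φ 0 = 1` there is `s₁ > 0` such that for every `R ≠ 0`, `κ` and `y` with
`|κ y| < s₁` the map is `C^∞` at `y` with `deriv ≠ 0` (`Φ(0) + 0 · Φ'(0) = 1`, continuity, and analyticity of `Φ` near
`0`). [folklore] -/
theorem insertionMap_smooth_deriv_ne {Φ : ℝ → ℝ} (hΦa : AnalyticAt ℝ Φ 0) (hΦ0 : Φ 0 = 1) :
    ∃ s₁ : ℝ, 0 < s₁ ∧ ∀ (R κ y : ℝ), R ≠ 0 → |κ * y| < s₁ →
      ContDiffAt ℝ ∞ (fun y => R * y * Φ (κ * y)) y ∧ deriv (fun y => R * y * Φ (κ * y)) y ≠ 0 := by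
  -- the function `φ(s) = Φ(s) + s Φ'(s)` is continuous at `0` with value `1`
  have hφ : ContinuousAt (fun s => Φ s + s * deriv Φ s) 0 :=
    hΦa.continuousAt.add (continuousAt_id.mul hΦa.deriv.continuousAt)
  have hφ0 : Φ 0 + 0 * deriv Φ 0 = 1 := by rw [hΦ0]; ring
  have hev : ∀ᶠ s in 𝓝 (0 : ℝ), 1 / 2 < Φ s + s * deriv Φ s :=
    hφ.eventually (lt_mem_nhds (show (1 : ℝ) / 2 < Φ 0 + 0 * deriv Φ 0 by rw [hφ0]; norm_num))
  obtain ⟨s₁, hs₁, hball⟩ := Metric.eventually_nhds_iff.mp (hev.and hΦa.eventually_analyticAt)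
  refine ⟨s₁, hs₁, fun R κ y hR hy => ?_⟩
  have hs : dist (κ * y) 0 < s₁ := by simpa [Real.dist_eq] using hy
  obtain ⟨hφs, hA⟩ := hball hs
  -- smoothness
  have hlin : ContDiffAt ℝ ∞ (fun y : ℝ => κ * y) y := contDiffAt_const.mul contDiffAt_id
  have hcomp : ContDiffAt ℝ ∞ (fun y : ℝ => Φ (κ * y)) y := hA.contDiffAt.comp y hlin
  have hsmooth : ContDiffAt ℝ ∞ (fun y => R * y * Φ (κ * y)) y :=
    (contDiffAt_const.mul contDiffAt_id).mul hcomp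
  refine ⟨hsmooth, ?_⟩
  -- the derivative
  have hder : HasDerivAt (fun y => R * y * Φ (κ * y)) (R * Φ (κ * y) + R * y * (deriv Φ (κ * y) * κ)) y := by
    have h1 : HasDerivAt (fun y : ℝ => R * y) R y := by
      simpa using (hasDerivAt_id y).const_mul R
    have h2 : HasDerivAt (fun y : ℝ => Φ (κ * y)) (deriv Φ (κ * y) * κ) y := by
      have hi : HasDerivAt Φ (deriv Φ (κ * y)) (κ * y) := hA.differentiableAt.hasDerivAt
      have hl : HasDerivAt (fun y : ℝ => κ * y) κ y := by simpa using (hasDerivAt_id y).const_mul κ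
      exact hi.comp y hl
    exact h1.mul h2
  rw [hder.deriv]
  have : R * Φ (κ * y) + R * y * (deriv Φ (κ * y) * κ) = R * (Φ (κ * y) + κ * y * deriv Φ (κ * y)) := by ring
  rw [this]
  exact mul_ne_zero hR (by linarith)

/-! ## §2 Cancelling a smooth left factor with non-vanishing derivative on the torus -/

/-- **A continuous function on `𝕋³` is smooth if its image under a local diffeomorphism of `ℝ` is smooth.** If
`β : 𝕋³ → ℝ` is continuous, `G : ℝ → ℝ` is `C^∞` with `deriv G ≠ 0` at every value `β x`, and `G ∘ β` is smooth,
then `β` is smooth: locally `β = G⁻¹ ∘ (G ∘ β)` with the `C^∞` local inverse of the inverse function theorem.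
(A general fact about `Torus.IsSmooth`; stated for `𝕋³` and kept in this namespace.) [folklore] -/
theorem torus_isSmooth_of_isSmooth_comp {β : T3 → ℝ} {G : ℝ → ℝ}
    (hβ : Continuous β) (hG : ∀ x, ContDiffAt ℝ ∞ G (β x)) (hG' : ∀ x, deriv G (β x) ≠ 0)
    (hs : Torus.IsSmooth (fun x => G (β x))) : Torus.IsSmooth β := by
  show ContDiff ℝ ∞ (Torus.lift β)
  rw [contDiff_iff_contDiffAt]
  intro p
  have hn : (∞ : WithTop ℕ∞) ≠ 0 := by simp
  set y₀ : ℝ := Torus.lift β p with hy₀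
  have hcd : ContDiffAt ℝ ∞ G y₀ := by rw [hy₀, Torus.lift_apply]; exact hG _
  have hne : deriv G y₀ ≠ 0 := by rw [hy₀, Torus.lift_apply]; exact hG' _
  have hder : HasStrictDerivAt G (deriv G y₀) y₀ := hcd.hasStrictDerivAt hn
  have hF := hder.hasStrictFDerivAt_equiv hne
  -- the smooth local inverse `g` of `G` at `y₀`
  have hg : ContDiffAt ℝ ∞ (hcd.localInverse hF.hasFDerivAt hn) (G y₀) := hcd.to_localInverse hF.hasFDerivAt hn
  have hleft : ∀ᶠ y in 𝓝 y₀, hcd.localInverse hF.hasFDerivAt hn (G y) = y :=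
    (hcd.hasStrictFDerivAt' hF.hasFDerivAt hn).eventually_left_inverse
  -- pull the identity `g (G y) = y` back along the continuous lift of `β`
  have hcont : ContinuousAt (Torus.lift β) p := (Torus.continuous_lift_iff.2 hβ).continuousAt
  have hev : Torus.lift β =ᶠ[𝓝 p]
      fun q => hcd.localInverse hF.hasFDerivAt hn (Torus.lift (fun x => G (β x)) q) := by
    filter_upwards [hcont.preimage_mem_nhds hleft] with q hq
    simp only [mem_preimage, mem_setOf_eq] at hq
    rw [Torus.lift_apply] at hq ⊢
    rw [Torus.lift_apply]
    exact hq.symm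
  have hGy : Torus.lift (fun x => G (β x)) p = G y₀ := by rw [Torus.lift_apply, hy₀, Torus.lift_apply]
  have hcomp : ContDiffAt ℝ ∞ (fun q => hcd.localInverse hF.hasFDerivAt hn (Torus.lift (fun x => G (β x)) q)) p := by
    refine ContDiffAt.comp p ?_ hs.contDiffAt
    rw [hGy]; exact hg
  exact hcomp.congr_of_eventuallyEq hev

/-! ## §3 Below a profile threshold, a smooth pinned density forces a smooth activity -/

/-- **`rhoLim P σ` smooth ⇒ `β` smooth**, for `σ` below a threshold depending only on the profile: with `SmallDensity P σ`
(so `R = ratioLimit P σ ∈ [1/2, 2]`), `σ < 1` and `2 M σ < s₁` the argument `σ³ R β(x)` of the insertion factor stays in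
the interval `|s| < s₁` of `insertionMap_smooth_deriv_ne` (for the insertion series `Φ` of `EosRatioAnalytic.eosPhi_spec`),
and §2 applies to `rhoLim P σ = G ∘ β`, `G y = R y Φ(σ³ R y)`. [folklore] -/
theorem isSmooth_β_of_isSmooth_rhoLim (P : DensityProfile) :
    ∃ σ₁ : ℝ, 0 < σ₁ ∧ ∀ σ : ℝ, 0 < σ → σ < σ₁ → SmallDensity P σ →
      Torus.IsSmooth (rhoLim P σ) → Torus.IsSmooth P.β := by
  obtain ⟨Φ, hΦ, hΦa, hΦ0, -⟩ := EosRatioAnalytic.eosPhi_spec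
  obtain ⟨s₁, hs₁, H⟩ := insertionMap_smooth_deriv_ne hΦa hΦ0
  have hM := P.M_pos
  refine ⟨min 1 (s₁ / (2 * P.M + 1)), lt_min one_pos (div_pos hs₁ (by linarith)), fun σ hσ hσlt hsd hsm => ?_⟩
  have hσ1 : σ < 1 := lt_of_lt_of_le hσlt (min_le_left _ _)
  have hσs : σ < s₁ / (2 * P.M + 1) := lt_of_lt_of_le hσlt (min_le_right _ _)
  set R := ratioLimit P σ with hR
  have hRmem := hsd.ratioLimit_mem
  have hRpos : 0 < R := hsd.ratioLimit_pos
  -- the argument of the insertion factor is small along the range of `β`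
  have harg : ∀ x, |σ ^ 3 * R * P.β x| < s₁ := by
    intro x
    have hβ0 := (P.pos x).le
    have hβM := P.le_M x
    have hσ3 : σ ^ 3 ≤ σ := by
      have := pow_le_pow_of_le_one hσ.le hσ1.le (show 1 ≤ 3 by norm_num)
      simpa using this
    rw [abs_of_nonneg (by positivity)]
    calc σ ^ 3 * R * P.β x ≤ σ * 2 * P.M := by
          have h1 : σ ^ 3 * R ≤ σ * 2 := mul_le_mul hσ3 hRmem.2 hRpos.le hσ.le
          exact mul_le_mul h1 hβM hβ0 (by positivity)
      _ < s₁ := by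
          have h2 : σ * (2 * P.M + 1) < s₁ := by rwa [lt_div_iff₀ (by linarith)] at hσs
          nlinarith
  have hfun : (fun x => R * P.β x * Φ (σ ^ 3 * R * P.β x)) = rhoLim P σ :=
    funext fun x => (rhoLim_eq_insertion hΦ P σ x).symm
  refine torus_isSmooth_of_isSmooth_comp (G := fun y => R * y * Φ (σ ^ 3 * R * y)) P.continuous
    (fun x => (H R (σ ^ 3 * R) (P.β x) hRpos.ne' (harg x)).1)
    (fun x => (H R (σ ^ 3 * R) (P.β x) hRpos.ne' (harg x)).2) ?_
  show Torus.IsSmooth (fun x => R * P.β x * Φ (σ ^ 3 * R * P.β x))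
  rwa [hfun]

/-- The activity is `(∫ a₀) •` its profile. [folklore] -/
theorem smul_profileOf_β {a₀ : T3 → ℝ} (ha : Continuous a₀) (ha0 : ∀ x, 0 < a₀ x) :
    (∫ y, a₀ y) • (profileOf a₀ ha ha0).β = a₀ := by
  funext x
  rw [Pi.smul_apply, profileOf_β, smul_eq_mul, mul_div_cancel₀ _ (integral_pos_of_continuous_pos ha ha0).ne']

/-- **Profiles that admit a TIED classical solution at a small `σ` are smooth.** For continuous positive profiles
there is `σ₁ > 0` such that for `0 < σ < σ₁`: if a classical hard-sphere Euler solution on `[0, T)`, `T > 0`, is tied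
at `t = 0` to the local Gibbs laws through some flow family, then `a₀`, `u₀`, `θ₀` are `C^∞` — the data are pinned
(`admissible_iff_data`: `ρ 0 = rhoLim (profileOf a₀) σ`, `u 0 = u₀`, `θ 0 = θ₀`), time-`0` slices of a classical
solution are smooth, and §3 transfers smoothness from `rhoLim` to `a₀`. [folklore] -/
theorem isSmooth_profiles_of_tied {a₀ θ₀ : T3 → ℝ} {u₀ : T3 → V3} (ha : Continuous a₀) (hθ : Continuous θ₀)
    (hu : Continuous u₀) (ha0 : ∀ x, 0 < a₀ x) (hθ0 : ∀ x, 0 < θ₀ x) :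
    ∃ σ₁ : ℝ, 0 < σ₁ ∧ ∀ σ : ℝ, 0 < σ → σ < σ₁ →
      ∀ (T : ℝ) (ρ θ : ℝ → T3 → ℝ) (u : ℝ → T3 → V3), IsHardSphereEulerSolution σ T ρ u θ → 0 < T →
        ∀ Φ : Flows σ, TendstoHydroFieldsAt (fun N => localGibbsLaw σ a₀ u₀ θ₀ N (Φ N)) Φ ρ u θ 0 →
        Torus.IsSmooth a₀ ∧ Torus.IsSmooth u₀ ∧ Torus.IsSmooth θ₀ := by
  obtain ⟨σA, hσA, -, A⟩ := admissible_iff_data ha hθ hu ha0 hθ0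
  obtain ⟨σS, hσS, S⟩ := isSmooth_β_of_isSmooth_rhoLim (profileOf a₀ ha ha0)
  refine ⟨min σA σS, lt_min hσA hσS, fun σ hσ hσlt T ρ θ u hE hT Φ h0 => ?_⟩
  have hσA' : σ < σA := lt_of_lt_of_le hσlt (min_le_left _ _)
  have hσS' : σ < σS := lt_of_lt_of_le hσlt (min_le_right _ _)
  have h0mem : (0 : ℝ) ∈ Ico 0 T := ⟨le_rfl, hT⟩
  obtain ⟨hρc, huc, hθc⟩ := continuous_slices_zero hE hT
  obtain ⟨hsd, A'⟩ := A σ hσ hσA'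
  obtain ⟨h1, h2, h3⟩ := (A' ρ θ u hρc huc hθc).1 fun Ψ =>
    (tendstoHydroFieldsAt_zero_iff_flowFree Ψ).2 ((tendstoHydroFieldsAt_zero_iff_flowFree Φ).1 h0)
  have hρs : Torus.IsSmooth (ρ 0) := hE.smooth_density.isSmooth_slice h0mem
  rw [h1] at hρs
  have hβ : Torus.IsSmooth (profileOf a₀ ha ha0).β := S σ hσ hσS' hsd hρs
  refine ⟨?_, ?_, ?_⟩
  · rw [← smul_profileOf_β ha ha0]; exact hβ.smul _
  · rw [← h2]; exact hE.smooth_velocity.isSmooth_slice h0mem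
  · rw [← h3]; exact hE.smooth_temperature.isSmooth_slice h0mem

/-- **Non-smooth profiles carry no content.** If one of `a₀, u₀, θ₀` is not `C^∞` then, below the threshold of
`isSmooth_profiles_of_tied`, the inner implication of the packing-guarded hydrodynamic limit holds VACUOUSLY at every
`σ` and for every cap `η` (no classical solution is tied). [folklore] -/
theorem inner_holds_of_not_isSmooth_profiles {a₀ θ₀ : T3 → ℝ} {u₀ : T3 → V3} (ha : Continuous a₀)
    (hθ : Continuous θ₀) (hu : Continuous u₀) (ha0 : ∀ x, 0 < a₀ x) (hθ0 : ∀ x, 0 < θ₀ x)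
    (hns : ¬ (Torus.IsSmooth a₀ ∧ Torus.IsSmooth u₀ ∧ Torus.IsSmooth θ₀)) :
    ∃ σ₁ : ℝ, 0 < σ₁ ∧ ∀ σ : ℝ, 0 < σ → σ < σ₁ → ∀ η : ℝ,
      ∀ (T : ℝ) (ρ θ : ℝ → T3 → ℝ) (u : ℝ → T3 → V3), IsHardSphereEulerSolution σ T ρ u θ →
        (∀ t ∈ Ico 0 T, ∀ x, ρ t x * σ ^ 3 < η) →
        ∀ Φ : Flows σ, TendstoHydroFieldsAt (fun N => localGibbsLaw σ a₀ u₀ θ₀ N (Φ N)) Φ ρ u θ 0 →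
        ∀ t ∈ Ico 0 T, TendstoHydroFieldsAt (fun N => localGibbsLaw σ a₀ u₀ θ₀ N (Φ N)) Φ ρ u θ t := by
  obtain ⟨σ₁, hσ₁, S⟩ := isSmooth_profiles_of_tied ha hθ hu ha0 hθ0
  refine ⟨σ₁, hσ₁, fun σ hσ hσlt η T ρ θ u hE _ Φ h0 t ht => ?_⟩
  exact absurd (S σ hσ hσlt T ρ θ u hE (ht.1.trans_lt ht.2) Φ h0) hns

/-! ## §4 The cruxes are equivalent to their restrictions to smooth profiles -/

open Summit.AtomisticToContinuum.HydrodynamicLimit.Theses.ImplosionDichotomy (HydroLimitProfilewiseBand HydroLimitInBand)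

/-- **The profile-wise crux is a statement about smooth profiles**: `HydroLimitProfilewiseBand` (stmt-17372) is
equivalent to the same statement with `Continuous a₀ → Continuous θ₀ → Continuous u₀` replaced by
`Torus.IsSmooth a₀ → Torus.IsSmooth θ₀ → Torus.IsSmooth u₀` (everything else verbatim). (`→`: smooth profiles are
continuous. `←`: for continuous profiles that are not all smooth the inner implication is vacuous below `σ₁(a₀,u₀,θ₀)`,
`inner_holds_of_not_isSmooth_profiles`; take `η := 1`.) [folklore] -/
theorem hydroLimitProfilewiseBand_iff_smooth :
    HydroLimitProfilewiseBand ↔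
      ∀ (a₀ θ₀ : T3 → ℝ) (u₀ : T3 → V3), Torus.IsSmooth a₀ → Torus.IsSmooth θ₀ → Torus.IsSmooth u₀ →
        (∀ x, 0 < a₀ x) → (∀ x, 0 < θ₀ x) → ∃ η : ℝ, 0 < η ∧ ∃ σ₀ : ℝ, 0 < σ₀ ∧ ∀ σ : ℝ, 0 < σ → σ < σ₀ →
        ∀ (T : ℝ) (ρ θ : ℝ → T3 → ℝ) (u : ℝ → T3 → V3), IsHardSphereEulerSolution σ T ρ u θ →
        (∀ t ∈ Ico 0 T, ∀ x, ρ t x * σ ^ 3 < η) →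
        ∀ Φ : Flows σ, TendstoHydroFieldsAt (fun N => localGibbsLaw σ a₀ u₀ θ₀ N (Φ N)) Φ ρ u θ 0 →
        ∀ t ∈ Ico 0 T, TendstoHydroFieldsAt (fun N => localGibbsLaw σ a₀ u₀ θ₀ N (Φ N)) Φ ρ u θ t := by
  refine ⟨fun h a₀ θ₀ u₀ ha hθ hu ha0 hθ0 => h a₀ θ₀ u₀ ha.continuous hθ.continuous hu.continuous ha0 hθ0,
    fun h a₀ θ₀ u₀ ha hθ hu ha0 hθ0 => ?_⟩
  by_cases hs : Torus.IsSmooth a₀ ∧ Torus.IsSmooth u₀ ∧ Torus.IsSmooth θ₀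
  · exact h a₀ θ₀ u₀ hs.1 hs.2.2 hs.2.1 ha0 hθ0
  · obtain ⟨σ₁, hσ₁, V⟩ := inner_holds_of_not_isSmooth_profiles ha hθ hu ha0 hθ0 hs
    exact ⟨1, one_pos, σ₁, hσ₁, fun σ hσ hσlt => V σ hσ hσlt 1⟩

/-- **The uniform crux (= the Statement) is a statement about smooth profiles**: `HydroLimitInBand` (stmt-9133) is
equivalent to the same statement over `C^∞` profiles (same argument; the cap `η₀` is taken from the smooth form).
[folklore] -/
theorem hydroLimitInBand_iff_smooth :
    HydroLimitInBand ↔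
      ∃ η₀ : ℝ, 0 < η₀ ∧ ∀ (a₀ θ₀ : T3 → ℝ) (u₀ : T3 → V3), Torus.IsSmooth a₀ → Torus.IsSmooth θ₀ →
        Torus.IsSmooth u₀ → (∀ x, 0 < a₀ x) → (∀ x, 0 < θ₀ x) → ∃ σ₀ : ℝ, 0 < σ₀ ∧ ∀ σ : ℝ, 0 < σ → σ < σ₀ →
        ∀ (T : ℝ) (ρ θ : ℝ → T3 → ℝ) (u : ℝ → T3 → V3), IsHardSphereEulerSolution σ T ρ u θ →
        (∀ t ∈ Ico 0 T, ∀ x, ρ t x * σ ^ 3 < η₀) →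
        ∀ Φ : Flows σ, TendstoHydroFieldsAt (fun N => localGibbsLaw σ a₀ u₀ θ₀ N (Φ N)) Φ ρ u θ 0 →
        ∀ t ∈ Ico 0 T, TendstoHydroFieldsAt (fun N => localGibbsLaw σ a₀ u₀ θ₀ N (Φ N)) Φ ρ u θ t := by
  refine ⟨fun ⟨η₀, hη₀, H⟩ => ⟨η₀, hη₀, fun a₀ θ₀ u₀ ha hθ hu ha0 hθ0 =>
    H a₀ θ₀ u₀ ha.continuous hθ.continuous hu.continuous ha0 hθ0⟩, fun ⟨η₀, hη₀, H⟩ => ⟨η₀, hη₀, ?_⟩⟩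
  intro a₀ θ₀ u₀ ha hθ hu ha0 hθ0
  by_cases hs : Torus.IsSmooth a₀ ∧ Torus.IsSmooth u₀ ∧ Torus.IsSmooth θ₀
  · exact H a₀ θ₀ u₀ hs.1 hs.2.2 hs.2.1 ha0 hθ0
  · obtain ⟨σ₁, hσ₁, V⟩ := inner_holds_of_not_isSmooth_profiles ha hθ hu ha0 hθ0 hs
    exact ⟨σ₁, hσ₁, fun σ hσ hσlt => V σ hσ hσlt η₀⟩

/-- The crux `HydroLimitInBand` is verbatim the sub-problem Statement `HydrodynamicLimit`. [folklore] -/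
theorem hydroLimitInBand_iff_statement : HydroLimitInBand ↔ _root_.HydrodynamicLimit :=
  Iff.rfl

/-- **The sub-problem Statement is a statement about smooth profiles**: `HydrodynamicLimit` (the packing-guarded
hydrodynamic limit, conjunct of `AtomisticToContinuum`) is equivalent to its restriction to `C^∞` profiles
`(a₀, θ₀, u₀)`. [folklore] -/
theorem statement_iff_smooth :
    _root_.HydrodynamicLimit ↔
      ∃ η₀ : ℝ, 0 < η₀ ∧ ∀ (a₀ θ₀ : T3 → ℝ) (u₀ : T3 → V3), Torus.IsSmooth a₀ → Torus.IsSmooth θ₀ →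
        Torus.IsSmooth u₀ → (∀ x, 0 < a₀ x) → (∀ x, 0 < θ₀ x) → ∃ σ₀ : ℝ, 0 < σ₀ ∧ ∀ σ : ℝ, 0 < σ → σ < σ₀ →
        ∀ (T : ℝ) (ρ θ : ℝ → T3 → ℝ) (u : ℝ → T3 → V3), IsHardSphereEulerSolution σ T ρ u θ →
        (∀ t ∈ Ico 0 T, ∀ x, ρ t x * σ ^ 3 < η₀) →
        ∀ Φ : Flows σ, TendstoHydroFieldsAt (fun N => localGibbsLaw σ a₀ u₀ θ₀ N (Φ N)) Φ ρ u θ 0 →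
        ∀ t ∈ Ico 0 T, TendstoHydroFieldsAt (fun N => localGibbsLaw σ a₀ u₀ θ₀ N (Φ N)) Φ ρ u θ t :=
  hydroLimitInBand_iff_statement.symm.trans hydroLimitInBand_iff_smooth

end HydroLimitBandSmooth

end Summit.AtomisticToContinuum.HydrodynamicLimit.Theorems

end
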